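import Summits.QuantumFields.BalabanUV.Beta.GAN24.TaylorBlockSum

/-!
# `BalabanUV.Beta.GAN24.OffDiagSandwichFlat` — binder row G-an2-4 / (CONV-C), S-slot, road «S3-Taylor» (gan24-p1 `SKELETON-S3.md` v1.1 §16,
# rows Vt / V / V0): THE OFF-DIAGONAL SANDWICH ENGINE, part 1 — FINITE-RANGE TABLES MAKE THE INNER SERIES FINITE SUMS, AND THE
# `y`-INTEGRAND OF A ONE-CHANNEL UNIT SANDWICH IS DOMINATED BY A FLAT FINITE SUM (so that bounded flat sums bound the channel)

NOT IN PRINT; OUR BOOKKEEPING (engine of the G-an2-4 swarm leaf seat `b2b-balaban-gan24-formalise-leaf-14`, gen 18, holder of SHAPE row V by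
INTENT «ROW-V*», journal l.4689; part 2 = `GAN24/OffDiagSandwich` (reordering, the core estimate, the two sandwich theorems)).  HONEST FRAMING
(cell contract, verbatim): «discharging `BetaPertH` makes Bałaban's UV stability UNCONDITIONAL — a real constructive-QFT result; it is NOT the
continuum limit and NOT the Clay problem.»  HONEST DEPENDENCY (verbatim): «continuum YM on T⁴ ⇐ BetaPertH ∧ nine spine estimates (0/9 proved);
BetaPertH ⇐ (D1) ∧ (D4) ∧ CAP+tail; G-an2-4 gates asym, D1 and NE2/3/4.»  [folklore] finite combinatorics on `ℤ^D` and real bookkeeping: cites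
nothing, mints no `def`, no `def … : Prop`, uses no object of an1/an2/an3, instantiates no wall binder.  Discharges NOTHING of row V, of
«E3Shape»/«E3SupRate», of (hS, hSall); NOT BetaPertH, NOT continuum, NOT Clay.

## Why (context only; asserted nowhere below)
Every (V-H) row of the S3 table (`StencilSlotE3OfPieces.e3Shape_of_pieces`, hypotheses `hVt`/`hV`/`hV0`) is, after leaf-01's unit split
`E3UnitSplit.e3VH_unit_split`, a bound on the sum of TWO literally nested one-channel sandwiches of the shape
`Σ'_y Σ_{l′} (Σ'_w Σ_l A_l(w) · Σ_k c · Σ'_u B_k(u) · T_k(u; w, y)_{l l′}) · K_{l′}(y)` (`c = N^{−D}`; legs `A`, `B`, `K` = the normalised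
resolvent legs `G̃`/`Φ̃`, `H̃`, `Φ̃`/`H̃`; table `T` = the pushed border increment `pushSum … (borderInc …)` read in one off-diagonal block).  The
table has FINITE `ℓ¹`-RANGE in both sites around the vertex location `u` (VH1 `TaylorMassVHPush.pushSum_borderInc_inl_inr_ne_zero`), so no
Fubini theorem is needed: the two inner series are finite sums (§2), the `y`-integrand is dominated by a flat finite sum of absolute values,
and a bound on the flat sums over ALL finite site sets bounds the channel (`abs_channel_le_of_finset_bound`, summability of the outer series
being a by-product).  Part 2 bounds the flat sums.

## Contents (all [folklore]; `D` the dimension, `ι` a finite fibre-index type)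
§1 `mem_box_of_l1_le` (an `ℓ¹`-ball sits in the sup-box `Fintype.piFinset (Icc (c j − r) (c j + r))`), `card_box` (`(2r+1)^D` points),
   `card_filter_l1_le` (at most `(2r+1)^D` points of any finite set within `ℓ¹`-distance `r`), `abs_tsum_le_of_sum_abs_le` (bounded partial sums
   of `|f|` bound `|Σ' f|`).
§2 for a table with `T_k(u; w, y)_{l l′} ≠ 0 ⇒ |w − u|₁ ≤ r₁ ∧ |y − u|₁ ≤ r₂`: `tsum_u_eq_sum` (the `u`-series is the sum over the box of radius
   `r₁` around `w`), `tsum_w_eq_sum` (the `w`-series is the sum over the box of radius `r₁ + r₂` around `y`), `flatten_eq` (distributivity),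
   `abs_integrand_le` (domination of the `y`-integrand by the flat sum of `|A_l(w)|·(c·(|B_k(u)|·|T|))·|K_{l′}(y)|`, `0 ≤ c`), `summand_nonneg`,
   **`abs_channel_le_of_finset_bound`** (flat sums `≤ Bd` over all finite `U, W, Y` ⇒ `|channel| ≤ Bd`);
   v1.1 (append-only): `sum_abs_integrand_le` (the partial sums of the integrand's absolute value are `≤ Bd`), `summable_integrand`.
-/

noncomputable section

open Finset
open scoped BigOperators
open Literature.MathematicalPhysics.QuantumFieldTheory
open Literature.MathematicalPhysics.QuantumFieldTheory.Balaban1983to89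
open Literature.MathematicalPhysics.QuantumFieldTheory.Balaban1983to89.Beta
open B12Sec2to5 (l1 l1_nonneg)
open ExpKernelCalculus (l1_sub_triangle l1_sub_symm)

namespace Summit.QuantumFields.BalabanUV.Beta.GAN24.OffDiagSandwichFlat

variable {D : ℕ}

/-! ## §1 `ℓ¹`-balls sit in sup-boxes; box counts; bounded partial sums -/

/-- [folklore] A point within `ℓ¹`-distance `r` of `c` lies in the sup-box of radius `r` around `c`. -/
theorem mem_box_of_l1_le {c w : Fin D → ℤ} {r : ℕ} (h : l1 (w - c) ≤ r) :
    w ∈ Fintype.piFinset fun j => Finset.Icc (c j - r) (c j + r) := by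
  rw [Fintype.mem_piFinset]
  intro j
  rw [Finset.mem_Icc]
  have hj : |(((w - c) j : ℤ) : ℝ)| ≤ r :=
    le_trans (Finset.single_le_sum (f := fun μ => |(((w - c) μ : ℤ) : ℝ)|) (fun μ _ => abs_nonneg _)
      (Finset.mem_univ j)) h
  have hj' : ((|w j - c j| : ℤ) : ℝ) ≤ (r : ℝ) := by
    have e : ((|w j - c j| : ℤ) : ℝ) = |(((w - c) j : ℤ) : ℝ)| := by push_cast [Pi.sub_apply]; rfl
    rw [e]; exact hj
  have hz : (|w j - c j| : ℤ) ≤ (r : ℤ) := by exact_mod_cast hj'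
  constructor
  · have := (abs_le.1 hz).1; omega
  · have := (abs_le.1 hz).2; omega

/-- [folklore] The sup-box of radius `r` has `(2r+1)^D` points. -/
theorem card_box (c : Fin D → ℤ) (r : ℕ) :
    (Fintype.piFinset fun j => Finset.Icc (c j - r) (c j + r)).card = (2 * r + 1) ^ D := by
  rw [Fintype.card_piFinset]
  have h : ∀ j, (Finset.Icc (c j - r) (c j + r)).card = 2 * r + 1 := fun j => by
    rw [Int.card_Icc]; omega
  simp only [h, Finset.prod_const, Finset.card_univ, Fintype.card_fin]

/-- [folklore] The number of points of ANY finite set within `ℓ¹`-distance `r` of `c` is at most `(2r+1)^D`. -/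
theorem card_filter_l1_le (P : Finset (Fin D → ℤ)) (c : Fin D → ℤ) (r : ℕ) :
    ((P.filter fun p => l1 (p - c) ≤ r).card : ℝ) ≤ (2 * r + 1 : ℝ) ^ D := by
  have h : (P.filter fun p => l1 (p - c) ≤ r).card ≤ (2 * r + 1) ^ D := by
    rw [← card_box c r]
    refine Finset.card_le_card fun p hp => ?_
    rw [Finset.mem_filter] at hp
    exact mem_box_of_l1_le hp.2
  exact_mod_cast h

/-- [folklore] Bounded partial sums of `|f|` bound `|∑' f|` (summability included). -/
theorem abs_tsum_le_of_sum_abs_le {β : Type*} {f : β → ℝ} {a : ℝ} (h : ∀ s : Finset β, ∑ i ∈ s, |f i| ≤ a) :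
    |∑' i, f i| ≤ a := by
  have hs : Summable fun i => |f i| := summable_of_sum_le (fun i => abs_nonneg _) h
  have hle : ∑' i, |f i| ≤ a := Real.tsum_le_of_sum_le (fun i => abs_nonneg _) h
  have h1 : |∑' i, f i| ≤ ∑' i, |f i| := by
    have := norm_tsum_le_tsum_norm (f := f) (by simpa only [Real.norm_eq_abs] using hs)
    simpa only [Real.norm_eq_abs] using this
  exact h1.trans hle


/-! ## §2 Finite-range tables: the inner series are finite sums; the `y`-integrand is dominated by a flat finite sum -/

section Table

variable {ι : Type*} [Fintype ι]
variable (A B K : ι → (Fin D → ℤ) → ℝ) (T : ι → (Fin D → ℤ) → (Fin D → ℤ) → (Fin D → ℤ) → ι → ι → ℝ) (c : ℝ)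
  {r₁ r₂ : ℕ}

omit [Fintype ι] in
/-- [folklore] With a table of `ℓ¹`-range `r₁` in its first site, the innermost `u`-series is a finite sum over the sup-box of
radius `r₁` around `w`. -/
theorem tsum_u_eq_sum (hTs : ∀ k u w y l l', T k u w y l l' ≠ 0 → l1 (w - u) ≤ r₁ ∧ l1 (y - u) ≤ r₂)
    (k : ι) (w y : Fin D → ℤ) (l l' : ι) :
    ∑' u, B k u * T k u w y l l' =
      ∑ u ∈ Fintype.piFinset (fun j => Finset.Icc (w j - r₁) (w j + r₁)), B k u * T k u w y l l' := by
  refine tsum_eq_sum fun u hu => ?_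
  have h0 : T k u w y l l' = 0 := by
    by_contra hne
    exact hu (mem_box_of_l1_le (by rw [l1_sub_symm]; exact (hTs k u w y l l' hne).1))
  rw [h0, mul_zero]

/-- [folklore] … and the `w`-series is a finite sum over the sup-box of radius `r₁ + r₂` around `y`. -/
theorem tsum_w_eq_sum (hTs : ∀ k u w y l l', T k u w y l l' ≠ 0 → l1 (w - u) ≤ r₁ ∧ l1 (y - u) ≤ r₂)
    (y : Fin D → ℤ) (l' : ι) :
    ∑' w, ∑ l, A l w * ∑ k, c * ∑' u, B k u * T k u w y l l' =
      ∑ w ∈ Fintype.piFinset (fun j => Finset.Icc (y j - (r₁ + r₂ : ℕ)) (y j + (r₁ + r₂ : ℕ))),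
        ∑ l, A l w * ∑ k, c * ∑' u, B k u * T k u w y l l' := by
  refine tsum_eq_sum fun w hw => ?_
  have h0 : ∀ k u l, T k u w y l l' = 0 := by
    intro k u l
    by_contra hne
    obtain ⟨h1, h2⟩ := hTs k u w y l l' hne
    refine hw (mem_box_of_l1_le ?_)
    have tri := l1_sub_triangle w u y
    rw [l1_sub_symm u y] at tri
    push_cast
    linarith
  simp only [h0, mul_zero, tsum_zero, Finset.sum_const_zero]

/-- [folklore] Flattening a product of nested finite sums (pure distributivity). -/
theorem flatten_eq (W : Finset (Fin D → ℤ)) (U : (Fin D → ℤ) → Finset (Fin D → ℤ)) (y : Fin D → ℤ) (l' : ι) :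
    (∑ w ∈ W, ∑ l, A l w * ∑ k, c * ∑ u ∈ U w, B k u * T k u w y l l') * K l' y =
      ∑ w ∈ W, ∑ l, ∑ k, ∑ u ∈ U w, A l w * (c * (B k u * T k u w y l l')) * K l' y := by
  rw [Finset.sum_mul]
  refine Finset.sum_congr rfl fun w _ => ?_
  rw [Finset.sum_mul]
  refine Finset.sum_congr rfl fun l _ => ?_
  rw [Finset.mul_sum, Finset.sum_mul]
  refine Finset.sum_congr rfl fun k _ => ?_
  rw [Finset.mul_sum, Finset.mul_sum, Finset.sum_mul]

/-- [folklore] **THE `y`-INTEGRAND IS DOMINATED BY A FLAT FINITE SUM** of the absolute values of the factors (`0 ≤ c`). -/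
theorem abs_integrand_le (hc : 0 ≤ c) (hTs : ∀ k u w y l l', T k u w y l l' ≠ 0 → l1 (w - u) ≤ r₁ ∧ l1 (y - u) ≤ r₂)
    (y : Fin D → ℤ) :
    |∑ l', (∑' w, ∑ l, A l w * ∑ k, c * ∑' u, B k u * T k u w y l l') * K l' y| ≤
      ∑ l', ∑ w ∈ Fintype.piFinset (fun j => Finset.Icc (y j - (r₁ + r₂ : ℕ)) (y j + (r₁ + r₂ : ℕ))), ∑ l, ∑ k,
        ∑ u ∈ Fintype.piFinset (fun j => Finset.Icc (w j - r₁) (w j + r₁)),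
          |A l w| * (c * (|B k u| * |T k u w y l l'|)) * |K l' y| := by
  have hw := tsum_w_eq_sum A B T c hTs
  have hu := tsum_u_eq_sum B T hTs
  simp_rw [hw, hu, flatten_eq]
  refine (Finset.abs_sum_le_sum_abs _ _).trans (Finset.sum_le_sum fun l' _ => ?_)
  refine (Finset.abs_sum_le_sum_abs _ _).trans (Finset.sum_le_sum fun w _ => ?_)
  refine (Finset.abs_sum_le_sum_abs _ _).trans (Finset.sum_le_sum fun l _ => ?_)
  refine (Finset.abs_sum_le_sum_abs _ _).trans (Finset.sum_le_sum fun k _ => ?_)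
  refine (Finset.abs_sum_le_sum_abs _ _).trans (Finset.sum_le_sum fun u _ => ?_)
  rw [abs_mul, abs_mul, abs_mul, abs_mul, abs_of_nonneg hc]

omit [Fintype ι] in
/-- [folklore] The flat summand is nonnegative (`0 ≤ c`). -/
theorem summand_nonneg (hc : 0 ≤ c) (k : ι) (u w y : Fin D → ℤ) (l l' : ι) :
    0 ≤ |A l w| * (c * (|B k u| * |T k u w y l l'|)) * |K l' y| := by positivity

/-- [folklore] **STEP A+B — BOUNDED FLAT SUMS ⇒ BOUNDED CHANNEL**: if the flat absolute sums over ALL finite site sets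
`U, W, Y` are `≤ Bd`, then the (literally nested) channel series is `≤ Bd` in absolute value (summability of the outer
series is part of the conclusion's proof, not a hypothesis). -/
theorem abs_channel_le_of_finset_bound (hc : 0 ≤ c)
    (hTs : ∀ k u w y l l', T k u w y l l' ≠ 0 → l1 (w - u) ≤ r₁ ∧ l1 (y - u) ≤ r₂) {Bd : ℝ}
    (hBd : ∀ U W Y : Finset (Fin D → ℤ),
      ∑ y ∈ Y, ∑ l', ∑ w ∈ W, ∑ l, ∑ k, ∑ u ∈ U, |A l w| * (c * (|B k u| * |T k u w y l l'|)) * |K l' y| ≤ Bd) :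
    |∑' y, ∑ l', (∑' w, ∑ l, A l w * ∑ k, c * ∑' u, B k u * T k u w y l l') * K l' y| ≤ Bd := by
  classical
  refine abs_tsum_le_of_sum_abs_le fun Y => ?_
  set BW : (Fin D → ℤ) → Finset (Fin D → ℤ) :=
    fun y => Fintype.piFinset (fun j => Finset.Icc (y j - (r₁ + r₂ : ℕ)) (y j + (r₁ + r₂ : ℕ))) with hBW
  set BU : (Fin D → ℤ) → Finset (Fin D → ℤ) := fun w => Fintype.piFinset (fun j => Finset.Icc (w j - r₁) (w j + r₁)) with hBU
  set W : Finset (Fin D → ℤ) := Y.biUnion BW with hWdef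
  set U : Finset (Fin D → ℤ) := W.biUnion BU with hUdef
  calc ∑ y ∈ Y, |∑ l', (∑' w, ∑ l, A l w * ∑ k, c * ∑' u, B k u * T k u w y l l') * K l' y|
      ≤ ∑ y ∈ Y, ∑ l', ∑ w ∈ BW y, ∑ l, ∑ k, ∑ u ∈ BU w, |A l w| * (c * (|B k u| * |T k u w y l l'|)) * |K l' y| :=
        Finset.sum_le_sum fun y _ => abs_integrand_le A B K T c hc hTs y
    _ ≤ ∑ y ∈ Y, ∑ l', ∑ w ∈ W, ∑ l, ∑ k, ∑ u ∈ U, |A l w| * (c * (|B k u| * |T k u w y l l'|)) * |K l' y| := by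
        refine Finset.sum_le_sum fun y hy => Finset.sum_le_sum fun l' _ => ?_
        have hsubW : BW y ⊆ W := Finset.subset_biUnion_of_mem BW hy
        calc ∑ w ∈ BW y, ∑ l, ∑ k, ∑ u ∈ BU w, |A l w| * (c * (|B k u| * |T k u w y l l'|)) * |K l' y|
            ≤ ∑ w ∈ BW y, ∑ l, ∑ k, ∑ u ∈ U, |A l w| * (c * (|B k u| * |T k u w y l l'|)) * |K l' y| := by
              refine Finset.sum_le_sum fun w hw => Finset.sum_le_sum fun l _ => Finset.sum_le_sum fun k _ => ?_
              have hwW : w ∈ W := hsubW hw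
              exact Finset.sum_le_sum_of_subset_of_nonneg (Finset.subset_biUnion_of_mem BU hwW)
                (fun u _ _ => summand_nonneg A B K T c hc k u w y l l')
          _ ≤ ∑ w ∈ W, ∑ l, ∑ k, ∑ u ∈ U, |A l w| * (c * (|B k u| * |T k u w y l l'|)) * |K l' y| :=
              Finset.sum_le_sum_of_subset_of_nonneg hsubW (fun w _ _ => Finset.sum_nonneg fun l _ =>
                Finset.sum_nonneg fun k _ => Finset.sum_nonneg fun u _ => summand_nonneg A B K T c hc k u w y l l')
    _ ≤ Bd := hBd U W Y


/-- [folklore] **THE PARTIAL SUMS OF THE `y`-INTEGRAND'S ABSOLUTE VALUE ARE `≤ Bd`** — the quantitative content of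
`abs_channel_le_of_finset_bound`, exported (v1.1) so that two channels sharing the outer site can be added before summing and so that
summability is available by name. -/
theorem sum_abs_integrand_le (hc : 0 ≤ c)
    (hTs : ∀ k u w y l l', T k u w y l l' ≠ 0 → l1 (w - u) ≤ r₁ ∧ l1 (y - u) ≤ r₂) {Bd : ℝ}
    (hBd : ∀ U W Y : Finset (Fin D → ℤ),
      ∑ y ∈ Y, ∑ l', ∑ w ∈ W, ∑ l, ∑ k, ∑ u ∈ U, |A l w| * (c * (|B k u| * |T k u w y l l'|)) * |K l' y| ≤ Bd)
    (Y : Finset (Fin D → ℤ)) :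
    ∑ y ∈ Y, |∑ l', (∑' w, ∑ l, A l w * ∑ k, c * ∑' u, B k u * T k u w y l l') * K l' y| ≤ Bd := by
  classical
  set BW : (Fin D → ℤ) → Finset (Fin D → ℤ) :=
    fun y => Fintype.piFinset (fun j => Finset.Icc (y j - (r₁ + r₂ : ℕ)) (y j + (r₁ + r₂ : ℕ))) with hBW
  set BU : (Fin D → ℤ) → Finset (Fin D → ℤ) := fun w => Fintype.piFinset (fun j => Finset.Icc (w j - r₁) (w j + r₁)) with hBU
  set W : Finset (Fin D → ℤ) := Y.biUnion BW with hWdef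
  set U : Finset (Fin D → ℤ) := W.biUnion BU with hUdef
  calc ∑ y ∈ Y, |∑ l', (∑' w, ∑ l, A l w * ∑ k, c * ∑' u, B k u * T k u w y l l') * K l' y|
      ≤ ∑ y ∈ Y, ∑ l', ∑ w ∈ BW y, ∑ l, ∑ k, ∑ u ∈ BU w, |A l w| * (c * (|B k u| * |T k u w y l l'|)) * |K l' y| :=
        Finset.sum_le_sum fun y _ => abs_integrand_le A B K T c hc hTs y
    _ ≤ ∑ y ∈ Y, ∑ l', ∑ w ∈ W, ∑ l, ∑ k, ∑ u ∈ U, |A l w| * (c * (|B k u| * |T k u w y l l'|)) * |K l' y| := by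
        refine Finset.sum_le_sum fun y hy => Finset.sum_le_sum fun l' _ => ?_
        have hsubW : BW y ⊆ W := Finset.subset_biUnion_of_mem BW hy
        calc ∑ w ∈ BW y, ∑ l, ∑ k, ∑ u ∈ BU w, |A l w| * (c * (|B k u| * |T k u w y l l'|)) * |K l' y|
            ≤ ∑ w ∈ BW y, ∑ l, ∑ k, ∑ u ∈ U, |A l w| * (c * (|B k u| * |T k u w y l l'|)) * |K l' y| := by
              refine Finset.sum_le_sum fun w hw => Finset.sum_le_sum fun l _ => Finset.sum_le_sum fun k _ => ?_
              have hwW : w ∈ W := hsubW hw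
              exact Finset.sum_le_sum_of_subset_of_nonneg (Finset.subset_biUnion_of_mem BU hwW)
                (fun u _ _ => summand_nonneg A B K T c hc k u w y l l')
          _ ≤ ∑ w ∈ W, ∑ l, ∑ k, ∑ u ∈ U, |A l w| * (c * (|B k u| * |T k u w y l l'|)) * |K l' y| :=
              Finset.sum_le_sum_of_subset_of_nonneg hsubW (fun w _ _ => Finset.sum_nonneg fun l _ =>
                Finset.sum_nonneg fun k _ => Finset.sum_nonneg fun u _ => summand_nonneg A B K T c hc k u w y l l')
    _ ≤ Bd := hBd U W Y

/-- [folklore] … hence the `y`-integrand is summable (v1.1; two channels split by `tsum_add` / `Summable.add`). -/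
theorem summable_integrand (hc : 0 ≤ c)
    (hTs : ∀ k u w y l l', T k u w y l l' ≠ 0 → l1 (w - u) ≤ r₁ ∧ l1 (y - u) ≤ r₂) {Bd : ℝ}
    (hBd : ∀ U W Y : Finset (Fin D → ℤ),
      ∑ y ∈ Y, ∑ l', ∑ w ∈ W, ∑ l, ∑ k, ∑ u ∈ U, |A l w| * (c * (|B k u| * |T k u w y l l'|)) * |K l' y| ≤ Bd) :
    Summable fun y => ∑ l', (∑' w, ∑ l, A l w * ∑ k, c * ∑' u, B k u * T k u w y l l') * K l' y :=
  (summable_of_sum_le (fun _ => abs_nonneg _) (sum_abs_integrand_le A B K T c hc hTs hBd)).of_abs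

end Table


end Summit.QuantumFields.BalabanUV.Beta.GAN24.OffDiagSandwichFlat

end
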